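import Summits.ABC.IUTFork.Repair.CandMochizuki6TensorLevels
import HarnessLib

/-!
# REPAIR branch B1 → RESCUE-H (D-0079, letter H) / CandMochizuki6ScreenKit — ZERO-COST SHAPE SCREEN (k3) on the tensor twins

PROOF-ONLY kit (0 definitions, no `Prop` fact; seat abc-iut-rp-m2 gen 4; companion of `Repair/CandMochizuki6TensorTwin` p441485 ✓ /
`TensorLevels` p441944 ✓ / `Nested*` p445961 ✓ p447773 ✓ p449604 ✓). For the RESCUE-H keep/kill protocol (plan/rescue-H/README.md §4 (k3)
«H⋆ is not scale-blind or shape-blind», (k2) «H⋆ → PilotKummerCompatHull elaborates») and rp-bar's BARRIER-SCREEN §1 R2 SHAPE. TAKES NO SIDE on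
[IUTchIII] Cor. 3.12 or on any author; candidates are HYPOTHESES; models are test objects; typed ≠ proved; instantiated ≠ endorsed.
[cite: ScholzeStix2018, §2.2 pp. 9–10] [claim: Mochizuki2012, status: disputed]

THE TWO BEDS (gen 3, every prime `p`; product-ideal frame on the two-summand packet `⊗^{j+1}(ℚ ⊕ ℚ)`): the SKEW twin `tSkew p`
(Θ = `B_{2,2}`, q = `B_{3,1}`: SAME volume, incomparable ideals) and the THIN twin `tThin p` (q = `B_{4,1}`: SMALLER volume than the hull,
incomparable). Both carry the typed Thm. 3.11 (i)(ii)(iii), `MultiradialCompat`, the bridge hypotheses, `|log(q)| > 0`, `ThetaRegionsAdm` and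
the THREE pins; at both the (xi-f) Licence, `GapH3` and the residual S FAIL while READING 0 (per-packet volume inequality; strict at `tThin`),
the typed Corollary (strict at `tThin`), RP-M32b / `VolumePinned` (at `tSkew`) HOLD.

THE KIT (§1): for an ARBITRARY candidate `H : Cand` (no shape-blindness hypothesis needed — contrast `tensor_shape_barrier`):
* `not_sufficient_of_holds_tSkew` / `not_sufficientH_of_holds_tSkew`: **if `H` holds at the skew twin it supplies neither S nor the Licence**;
* `not_sufficient_of_holds_tThin` / `not_sufficientH_of_holds_tThin`: **the same at the thin twin** — the bed that kills every PURE VOLUME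
  INEQUALITY (READING 0-type, «μ(q) ≤ μ(hull) (+ slack)», averaged/Statement-level typings read per packet) as a supplier of S_H, since READING 0
  holds there STRICTLY and the Licence fails (`CandMochizuki6Tensor.tThin_cells`-side facts `tThin_reading0`, `tThin_not_licence`);
* `volume_inequality_not_sufficientH`: the instance — READING 0 itself (`CandMochizuki6.H''`) is not `SufficientH` (re-derivation of gen 3's
  `tensor_reading0_ceiling` through the kit, as the usage pattern).
USAGE (R-H hands): to screen a typed `H⋆`, prove `H⋆ biIndex (tfull 2) (tThin 2) (tRhoThin 2) tEmpty` (or at `tSkew`) — usually a one-line volume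
computation with `tThin_qLocal` / `tSkew_qLocal` / `tSkew_thetaLocal` — and apply the kit: KILLED for (k2)/(k3) at zero prover-hours. A candidate
that FAILS at both twins passes this screen (it reads the SHAPE of the q-region, as `NestedH` does: `tSkew_not_nestedH`, `tThin_not_nestedH`).
HONEST SCOPE: toys of the TYPED interface (label-uniform Θ, exact `j²`-scaling ✗ as on every twin bed); a KILL here says «not a supplier over the
frozen interface», nothing about print. [cite: ScholzeStix2018, §2.2 pp. 9–10]
-/

noncomputable section

open Set

namespace Summit.ABC.IUTFork.Repair.CandMochizuki6ScreenKit

open Thm311 Cor312 Cor312Vol Literature.IUT.LogThetaLattice CandMochizuki6Tensor CandMochizuki6Vocabulary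

variable (H : Cand) (p : ℕ) [hp : Fact p.Prime]

/-! ## 1. The kit -/

/-- **A candidate holding at the SKEW tensor twin does not supply S** (all premises of `Repair.Sufficient` hold there; S fails). [folklore] -/
theorem not_sufficient_of_holds_tSkew (h : H biIndex (tfull p) (tSkew p) (tRho p) tEmpty) : ¬ Sufficient H := fun hS =>
  tSkew_not_S p (hS biIndex (tfull p) (tSkew p) (tRho p) tEmpty (tfull_statement p)
    (GluedMonoids.multiradialCompat_of_statement _ (tfull_statement p)) (tSkew_bridgeHyps p) (tSkew_absLogQPos p) (tSkew_thetaRegionsAdm p)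
    (tSkew_pinnedRegions3 p) h)

/-- **A candidate holding at the SKEW tensor twin does not supply the hull Licence** (`Repair.SufficientH`). [folklore] -/
theorem not_sufficientH_of_holds_tSkew (h : H biIndex (tfull p) (tSkew p) (tRho p) tEmpty) : ¬ SufficientH H := fun hS =>
  tSkew_not_licence p (hS biIndex (tfull p) (tSkew p) (tRho p) tEmpty (tfull_statement p)
    (GluedMonoids.multiradialCompat_of_statement _ (tfull_statement p)) (tSkew_bridgeHyps p) (tSkew_absLogQPos p) (tSkew_thetaRegionsAdm p)
    (tSkew_pinnedRegions3 p) h)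

/-- **A candidate holding at the THIN tensor twin does not supply S.** [folklore] -/
theorem not_sufficient_of_holds_tThin (h : H biIndex (tfull p) (tThin p) (tRhoThin p) tEmpty) : ¬ Sufficient H := fun hS =>
  tThin_not_S p (hS biIndex (tfull p) (tThin p) (tRhoThin p) tEmpty (tfull_statement p)
    (GluedMonoids.multiradialCompat_of_statement _ (tfull_statement p)) (tThin_premises p).1 (tThin_premises p).2 (tThin_thetaRegionsAdm p)
    (tThin_pinnedRegions3 p) h)

/-- **A candidate holding at the THIN tensor twin does not supply the hull Licence** — the screen that kills every pure volume-inequality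
typing (READING 0 holds there STRICTLY, the Licence fails). [folklore] -/
theorem not_sufficientH_of_holds_tThin (h : H biIndex (tfull p) (tThin p) (tRhoThin p) tEmpty) : ¬ SufficientH H := fun hS =>
  tThin_not_licence p (hS biIndex (tfull p) (tThin p) (tRhoThin p) tEmpty (tfull_statement p)
    (GluedMonoids.multiradialCompat_of_statement _ (tfull_statement p)) (tThin_premises p).1 (tThin_premises p).2 (tThin_thetaRegionsAdm p)
    (tThin_pinnedRegions3 p) h)

/-! ## 2. Usage pattern: the per-packet volume inequality is screened out as a supplier of S_H -/

omit hp in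
/-- **READING 0 (`CandMochizuki6.H''`, the per-packet volume inequality «μ(q) ≤ μ(ⁿ˒°𝒰)») is NOT `SufficientH`** — it holds at the thin twin
(prime `2`; any prime works). The one-line pattern every R-H volume-level candidate is screened with. [folklore] -/
theorem volume_inequality_not_sufficientH :
    ¬ SufficientH fun _ F P _ _ => CandMochizuki6.H'' F.toLatticeSituation P :=
  haveI : Fact (Nat.Prime 2) := ⟨Nat.prime_two⟩
  not_sufficientH_of_holds_tThin _ 2 (tThin_reading0 2).1

omit hp in
/-- … nor `Sufficient` (a fortiori; also directly: S fails at the thin twin). [folklore] -/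
theorem volume_inequality_not_sufficient :
    ¬ Sufficient fun _ F P _ _ => CandMochizuki6.H'' F.toLatticeSituation P :=
  haveI : Fact (Nat.Prime 2) := ⟨Nat.prime_two⟩
  not_sufficient_of_holds_tThin _ 2 (tThin_reading0 2).1

/-! ## 3. (k3) SHAPE PASS CERTIFICATES — v2 (gen 5), the contrapositives for the R-H keep/kill round

Companion of abc-iut-rp-bar's `Repair.k3_pass_certificate` (Barrier28, the SCALE half). For a candidate with a (k2) implication at level R or H
(`Repair.Sufficient` / `Repair.SufficientH`) the SHAPE half of (k3) is a COROLLARY: it FAILS at both killer twins at every prime (no separate cell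
to compute; the level-R skew-twin instance is abc-iut-rp-bar's `Repair.sufficient_not_holds_tSkew`, Barrier21 — cited, not restated), and ONE positive
cell at the identified tensor twin `tId` (or at the identified sphere twin `idSetting 2`) makes it NOT `QShapeBlind` by theorem. At level S the screen does NOT apply (`levelS_shape_exempt`: a shape-blind supplier of the Statement holding at all three twins exists —
READING 0), since the typed Corollary is itself shape-blind (`qShapeBlind_statement`). So the RH-K3 shape cell reads: (k2) at level R/H landed ⇒
«PASS (shape) by `k3_shape_certificate` ← k2 p<ID>»; level S ⇒ «N/A»; no (k2) yet ⇒ run §1 as a pre-kill. -/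

section Certificates

open Cor312Vol.NaiveWitness CandMochizuki6Separation

/-- **A supplier of the hull Licence FAILS at the thin twin** (contrapositive of `not_sufficientH_of_holds_tThin`). [folklore] -/
theorem not_holds_tThin_of_sufficientH (hS : SufficientH H) : ¬ H biIndex (tfull p) (tThin p) (tRhoThin p) tEmpty :=
  fun h => not_sufficientH_of_holds_tThin H p h hS

/-- **A supplier of the hull Licence FAILS at the skew twin** (contrapositive of `not_sufficientH_of_holds_tSkew`). [folklore] -/
theorem not_holds_tSkew_of_sufficientH (hS : SufficientH H) : ¬ H biIndex (tfull p) (tSkew p) (tRho p) tEmpty :=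
  fun h => not_sufficientH_of_holds_tSkew H p h hS

/-- A supplier of S fails at the thin twin (at the skew twin this is abc-iut-rp-bar's `Repair.sufficient_not_holds_tSkew`, Barrier21 —
cited, not restated). [folklore] -/
theorem not_holds_tThin_of_sufficient (hS : Sufficient H) : ¬ H biIndex (tfull p) (tThin p) (tRhoThin p) tEmpty :=
  fun h => not_sufficient_of_holds_tThin H p h hS

/-- **Shape-SENSITIVITY by theorem (tensor bed, every prime)**: a supplier of the Licence that HOLDS at the identified tensor twin `tId`
(one positive cell: S, Reading R3, Licence, `GapH3`, READING 0, `VolumePinned` and the Corollary hold there with every premise, `tId_profile`)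
is NOT `QShapeBlind` — the contrapositive of gen 3's `tensor_shape_barrier`. [folklore] -/
theorem shapeSensitive_of_sufficientH_of_holds_tId (hS : SufficientH H) (hA : H biIndex (tfull p) (tId p) (tRho p) (tPsiDatum p)) :
    ¬ QShapeBlind H := fun hH => (tensor_shape_barrier p H hH hA).2 hS

/-- The same for a supplier of S. [folklore] -/
theorem shapeSensitive_of_sufficient_of_holds_tId (hS : Sufficient H) (hA : H biIndex (tfull p) (tId p) (tRho p) (tPsiDatum p)) :
    ¬ QShapeBlind H := fun hH => (tensor_shape_barrier p H hH hA).1 hS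

omit hp in
/-- **Shape-sensitivity by theorem (sphere bed, prime `2`)**: a supplier of S or of the Licence that HOLDS at the identified sphere twin
`idSetting 2` is NOT `QShapeBlind` — the contrapositive of gen 3's `shape_barrier`. [folklore] -/
theorem shapeSensitive_of_holds_id (hS : Sufficient H ∨ SufficientH H)
    (hA : H Checks.toyIndex (sphereFull 2) (idSetting 2) (dualRho 2) (psiDatum 2)) : ¬ QShapeBlind H :=
  fun hH => (shape_barrier H hH hS).1 hA

omit hp in
/-- **LEVEL S IS EXEMPT.** READING 0 (`CandMochizuki6.H''`, RP-M36c) is `SufficientS` AND `QShapeBlind` AND holds at the thin, the skew and the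
identified tensor twins at every prime: the shape screen kills nothing at level S (the typed Corollary is itself shape-blind,
`qShapeBlind_statement`), so a Statement-level / budget-door candidate gets «N/A (level S)» in its RH-K3 shape cell. [folklore] -/
theorem levelS_shape_exempt :
    ∃ H₀ : Cand, SufficientS H₀ ∧ QShapeBlind H₀ ∧
      ∀ (q : ℕ) [Fact q.Prime], H₀ biIndex (tfull q) (tThin q) (tRhoThin q) tEmpty ∧ H₀ biIndex (tfull q) (tSkew q) (tRho q) tEmpty ∧
        H₀ biIndex (tfull q) (tId q) (tRho q) (tPsiDatum q) :=
  ⟨fun _ F P _ _ => CandMochizuki6.H'' F.toLatticeSituation P, reading0_sufficientS, qShapeBlind_reading0,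
    fun q _ => ⟨(tThin_reading0 q).1, tSkew_reading0 q, (tId_profile q).2.2.2.2.1⟩⟩

/-- **`k3_shape_certificate` — the SHAPE half of (k3) for a candidate with a (k2) implication at level R or H**: it FAILS at both killer
twins (thin, skew) at every prime, and if it HOLDS at the identified twin `tId` (one positive cell) it is not shape-blind. With abc-iut-rp-bar's
`Repair.k3_pass_certificate` (scale half) the whole (k3) screen of a (k2)-passing candidate is a corollary of its (k2) file and one positive cell.
[folklore] -/
theorem k3_shape_certificate (hS : Sufficient H ∨ SufficientH H) :
    ¬ H biIndex (tfull p) (tThin p) (tRhoThin p) tEmpty ∧ ¬ H biIndex (tfull p) (tSkew p) (tRho p) tEmpty ∧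
      (H biIndex (tfull p) (tId p) (tRho p) (tPsiDatum p) → ¬ QShapeBlind H) :=
  have hH : SufficientH H := hS.elim (sufficientH_of_sufficient H) id
  ⟨not_holds_tThin_of_sufficientH H p hH, not_holds_tSkew_of_sufficientH H p hH, shapeSensitive_of_sufficientH_of_holds_tId H p hH⟩

end Certificates

end Summit.ABC.IUTFork.Repair.CandMochizuki6ScreenKit

end
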